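import Mathlib
import Literature.Combinatorics.SetFamily.BollobasSetPairs
import HarnessLib

/-!
# Blocking sets: the Gyárfás `r^τ` bound, the Erdős–Lovász `r^r` bound, and two Helly-type theorems

S. Jukna, *Extremal Combinatorics — with applications in computer science* (1st ed., Springer 2001)
[Jukna2001], Chapter 10 "Blocking sets and the duality", §10.2 "The blocking number": Theorem 10.5
(Gyárfás 1987 [Gyarfas1987]), Theorem 10.6 (Erdős–Lovász 1975 [ErdosLovasz1975]), Corollary 10.8;
§10.3 "Generalized Helly theorems": Theorem 10.9 (Lovász 1979 [Lovasz2007]), Theorem 10.10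
(Erdős–Hajnal–Moon 1964 [ErdosHajnalMoon1964]) and Theorem 10.11 (Bollobás 1965 [Bollobas1965]),
with the proofs printed there.

A set `T` *blocks* a family `𝓕` (is a *blocking set* of `𝓕`) if it meets every member
(`∀ A ∈ 𝓕, (T ∩ A).Nonempty`); it is a *minimal* blocking set if moreover no `T - {y}` blocks
(`∀ y ∈ T, ∃ A ∈ 𝓕, Disjoint (T.erase y) A`); the *blocking number* `τ(𝓕)` is the least size of a
blocking set, which we render by the hypothesis "no set with fewer than `τ` points blocks `𝓕`"
(`∀ T, |T| < τ → ∃ A ∈ 𝓕, Disjoint T A`); the *rank* of `𝓕` is the largest size of a member. All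
these notions are spelled out in the statements (no new definitions).

* `card_minimalBlocking_supersets_le` — the backward induction of the printed proof of Theorem 10.5
  (run for minimal blocking sets, which also gives Corollary 10.8): the minimal blocking `s`-sets
  containing a fixed `I` number at most `r^{s-|I|}`.
* `card_minimalBlocking_le_pow` — **Corollary 10.8**: a family of rank `r` has at most `r^s`
  minimal blocking sets of size `s`.
* `gyarfas_card_minBlocking_le_pow` — **Theorem 10.5** (Gyárfás 1987): a family of rank `r` with
  blocking number `τ` has at most `r^τ` blocking sets of size `τ`.
* `card_le_pow_self_of_intersecting_of_blocking` — **Theorem 10.6** (Erdős–Lovász 1975): an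
  intersecting `r`-uniform family with `τ(𝓕) = r` has at most `r^r` members.
* `lovasz_blocking_helly` — **Theorem 10.9** (Lovász 1979): if `𝓕` is `r`-uniform and every `k ≥ 2`
  members of `𝓕` have a common point, then `τ(𝓕) ≤ (r-1)/(k-1) + 1`, i.e.
  `(τ - 1)(k - 1) ≤ r - 1`.
* `bollobas_blocking_helly` — **Theorem 10.11** (Bollobás 1965): if every at most `binom(s+r, r)`
  members of an `r`-uniform family can be blocked by `s` points then all members can (via Bollobás's
  set-pairs inequality `Literature.Combinatorics.SetFamily.sum_bollobasWeight_le_one`, Theorem 9.8);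
  `erdos_hajnal_moon` — **Theorem 10.10**, the case of graphs (`r = 2`).
-/

namespace Literature.Combinatorics.SetFamily

open Finset

variable {α : Type*} [DecidableEq α]

section Gyarfas

variable [Fintype α]

/-- The engine of the printed proof of Theorem 10.5 (backward induction on `|I|`), run for minimal
blocking sets: in a family of rank `r` (every member has at most `r` points), for every set `I` the
number of minimal blocking sets `T ⊇ I` with `|T| = |I| + j` is at most `r^j`. Indeed, if `I` itself
blocks then no proper superset is a minimal blocking set; otherwise some member `A` avoids `I`, every
blocking `T ⊇ I` contains `I ∪ {x}` for some `x ∈ A`, and there are at most `|A| ≤ r` choices of `x`.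
[cite: Jukna2001, Ch. 10 §10.2, proof of Theorem 10.5 and Corollary 10.8; Gyarfas1987] -/
theorem card_minimalBlocking_supersets_le (𝓕 : Finset (Finset α)) (r : ℕ)
    (hr : ∀ A ∈ 𝓕, A.card ≤ r) (j : ℕ) :
    ∀ I : Finset α,
      ((univ : Finset (Finset α)).filter fun T =>
          T.card = I.card + j ∧ I ⊆ T ∧ (∀ B ∈ 𝓕, (T ∩ B).Nonempty) ∧
            ∀ y ∈ T, ∃ B ∈ 𝓕, Disjoint (T.erase y) B).card ≤ r ^ j := by
  induction j with
  | zero =>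
    intro I
    rw [pow_zero, card_le_one]
    intro T hT T' hT'
    simp only [mem_filter, mem_univ, true_and, add_zero] at hT hT'
    rw [← eq_of_subset_of_card_le hT.2.1 hT.1.le, ← eq_of_subset_of_card_le hT'.2.1 hT'.1.le]
  | succ j ih =>
    intro I
    by_cases hI : ∀ B ∈ 𝓕, (I ∩ B).Nonempty
    · -- `I` blocks: no minimal blocking proper superset of `I`
      have h0 : ((univ : Finset (Finset α)).filter fun T =>
          T.card = I.card + (j + 1) ∧ I ⊆ T ∧ (∀ B ∈ 𝓕, (T ∩ B).Nonempty) ∧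
            ∀ y ∈ T, ∃ B ∈ 𝓕, Disjoint (T.erase y) B) = ∅ := by
        rw [filter_eq_empty_iff]
        rintro T - ⟨hcard, hIT, -, hmin⟩
        obtain ⟨x, hxT, hxI⟩ : ∃ x ∈ T, x ∉ I := by
          by_contra! h
          have := card_le_card (show T ⊆ I from h)
          omega
        obtain ⟨B, hB, hdisj⟩ := hmin x hxT
        obtain ⟨y, hy⟩ := hI B hB
        rw [mem_inter] at hy
        have hyx : y ≠ x := fun h => hxI (h ▸ hy.1)
        exact disjoint_left.mp hdisj (mem_erase.mpr ⟨hyx, hIT hy.1⟩) hy.2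
      rw [h0, card_empty]
      exact Nat.zero_le _
    · -- some member `A` avoids `I`; every blocking `T ⊇ I` contains `I ∪ {x}` for some `x ∈ A`
      push Not at hI
      obtain ⟨A, hA, hIA⟩ := hI
      calc _ ≤ (A.biUnion fun x => (univ : Finset (Finset α)).filter fun T =>
              T.card = (insert x I).card + j ∧ insert x I ⊆ T ∧ (∀ B ∈ 𝓕, (T ∩ B).Nonempty) ∧
                ∀ y ∈ T, ∃ B ∈ 𝓕, Disjoint (T.erase y) B).card := by
            apply card_le_card
            intro T hT
            simp only [mem_filter, mem_univ, true_and] at hT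
            obtain ⟨hcard, hIT, hblock, hmin⟩ := hT
            obtain ⟨x, hx⟩ := hblock A hA
            rw [mem_inter] at hx
            have hxI : x ∉ I := fun hxI => by
              have : x ∈ I ∩ A := mem_inter.mpr ⟨hxI, hx.2⟩
              rw [hIA] at this
              exact notMem_empty x this
            rw [mem_biUnion]
            refine ⟨x, hx.2, ?_⟩
            simp only [mem_filter, mem_univ, true_and]
            exact ⟨by rw [card_insert_of_notMem hxI]; omega, insert_subset hx.1 hIT, hblock, hmin⟩
        _ ≤ ∑ x ∈ A, r ^ j := card_biUnion_le.trans (sum_le_sum fun x _ => ih (insert x I))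
        _ = A.card * r ^ j := by rw [sum_const, smul_eq_mul]
        _ ≤ r * r ^ j := Nat.mul_le_mul_right _ (hr A hA)
        _ = r ^ (j + 1) := by rw [pow_succ']

/-- **Corollary 10.8.** A family of rank `r` has, for every `s`, at most `r^s` minimal blocking sets
of size `s`. [cite: Jukna2001, Ch. 10 §10.2, Corollary 10.8; Gyarfas1987] -/
theorem card_minimalBlocking_le_pow (𝓕 : Finset (Finset α)) (r s : ℕ)
    (hr : ∀ A ∈ 𝓕, A.card ≤ r) :
    ((univ : Finset (Finset α)).filter fun T =>
        T.card = s ∧ (∀ B ∈ 𝓕, (T ∩ B).Nonempty) ∧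
          ∀ y ∈ T, ∃ B ∈ 𝓕, Disjoint (T.erase y) B).card ≤ r ^ s := by
  have := card_minimalBlocking_supersets_le 𝓕 r hr s ∅
  simp only [card_empty, zero_add, empty_subset, true_and] at this
  exact this

/-- **Theorem 10.5** (Gyárfás 1987). Let `𝓕` be a family of rank `r` (every member has at most `r`
points) and let `τ = τ(𝓕)` be its blocking number (no set with fewer than `τ` points blocks `𝓕`).
Then the number of blocking sets of `𝓕` with `τ` elements is at most `r^τ`. (A blocking set of the
minimum size `τ` is a minimal blocking set, so this is Corollary 10.8 with `s = τ`.)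
[cite: Jukna2001, Ch. 10 §10.2, Theorem 10.5 and its proof; Gyarfas1987] -/
theorem gyarfas_card_minBlocking_le_pow (𝓕 : Finset (Finset α)) (r τ : ℕ)
    (hr : ∀ A ∈ 𝓕, A.card ≤ r) (hτ : ∀ T : Finset α, T.card < τ → ∃ B ∈ 𝓕, Disjoint T B) :
    ((univ : Finset (Finset α)).filter fun T =>
        T.card = τ ∧ ∀ B ∈ 𝓕, (T ∩ B).Nonempty).card ≤ r ^ τ := by
  refine le_trans (card_le_card fun T hT => ?_) (card_minimalBlocking_le_pow 𝓕 r τ hr)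
  simp only [mem_filter, mem_univ, true_and] at hT ⊢
  refine ⟨hT.1, hT.2, fun y hy => hτ _ ?_⟩
  have := card_pos.mpr ⟨y, hy⟩
  rw [card_erase_of_mem hy, hT.1]
  omega

/-- **Theorem 10.6** (Erdős–Lovász 1975). Let `𝓕` be an intersecting `r`-uniform family with
`τ(𝓕) = r` (no set with fewer than `r` points blocks `𝓕`). Then `|𝓕| ≤ r^r`: each member is a
blocking set of size `r = τ`, and Theorem 10.5 applies.
[cite: Jukna2001, Ch. 10 §10.2, Theorem 10.6 and its proof; ErdosLovasz1975] -/
theorem card_le_pow_self_of_intersecting_of_blocking (𝓕 : Finset (Finset α)) (r : ℕ)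
    (hr : ∀ A ∈ 𝓕, A.card = r) (hint : ∀ A ∈ 𝓕, ∀ B ∈ 𝓕, (A ∩ B).Nonempty)
    (hτ : ∀ T : Finset α, T.card < r → ∃ B ∈ 𝓕, Disjoint T B) : 𝓕.card ≤ r ^ r := by
  refine le_trans (card_le_card fun A hA => ?_)
    (gyarfas_card_minBlocking_le_pow 𝓕 r r (fun A hA => (hr A hA).le) hτ)
  simp only [mem_filter, mem_univ, true_and]
  exact ⟨hr A hA, hint A hA⟩

end Gyarfas

/-- **Theorem 10.9** (Lovász 1979). Let `𝓕` be `r`-uniform and suppose that every collection of at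
most `k` members of `𝓕` (`k ≥ 2`) has a common point. Then `τ(𝓕) ≤ (r - 1)/(k - 1) + 1`; precisely:
if no set with fewer than `t` points blocks `𝓕`, then `(t - 1)(k - 1) ≤ r - 1`.

Printed proof (by construction): select `A_1, …, A_j ∈ 𝓕` with
`1 ≤ |A_1 ∩ ⋯ ∩ A_j| ≤ r - (j-1)(τ-1)` for `j = 1, …, k`: the intersection `C` of the sets chosen
so far (`j ≤ k - 1`) blocks `𝓕`, hence `|C| ≥ τ`; a subset `S ⊆ C` with `|S| = τ - 1` does not block,
so some member `A_{j+1}` avoids `S`, and `|C ∩ A_{j+1}| ≤ |C| - (τ - 1)`. We carry the intersection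
`C` along explicitly. [cite: Jukna2001, Ch. 10 §10.3, Theorem 10.9 and its proof; Lovasz2007] -/
theorem lovasz_blocking_helly (𝓕 : Finset (Finset α)) (r k t : ℕ) (hk2 : 2 ≤ k)
    (hr : ∀ A ∈ 𝓕, A.card = r)
    (hk : ∀ 𝓖 ⊆ 𝓕, 𝓖.Nonempty → 𝓖.card ≤ k → ∃ x, ∀ A ∈ 𝓖, x ∈ A)
    (ht : ∀ T : Finset α, T.card < t → ∃ B ∈ 𝓕, Disjoint T B) :
    (t - 1) * (k - 1) ≤ r - 1 := by
  rcases Nat.eq_zero_or_pos t with rfl | ht1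
  · simp
  -- `𝓕` is non-empty (nothing of size `< t` blocks it, in particular not `∅`)
  obtain ⟨A₀, hA₀, -⟩ := ht ∅ (by simpa using ht1)
  have claim : ∀ j, 1 ≤ j → j ≤ k → ∃ 𝓖 ⊆ 𝓕, 𝓖.Nonempty ∧ 𝓖.card ≤ j ∧
      ∃ C : Finset α, (∀ x, x ∈ C ↔ ∀ A ∈ 𝓖, x ∈ A) ∧ C.card + (j - 1) * (t - 1) ≤ r := by
    intro j hj1 hjk
    induction j with
    | zero => omega
    | succ j ih =>
      rcases Nat.eq_zero_or_pos j with rfl | hj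
      · refine ⟨{A₀}, singleton_subset_iff.mpr hA₀, singleton_nonempty _, by simp, A₀,
          fun x => by simp, ?_⟩
        simp [hr A₀ hA₀]
      obtain ⟨𝓖, h𝓖𝓕, h𝓖ne, h𝓖card, C, hC, hCcard⟩ := ih hj (by omega)
      -- `C` blocks `𝓕`: any member together with `𝓖` is a collection of `≤ k` members
      have hCblock : ∀ B ∈ 𝓕, (C ∩ B).Nonempty := by
        intro B hB
        obtain ⟨x, hx⟩ := hk (insert B 𝓖) (insert_subset hB h𝓖𝓕) (insert_nonempty _ _)
          ((card_insert_le _ _).trans (by omega))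
        exact ⟨x, mem_inter.mpr ⟨(hC x).mpr fun A hA => hx A (mem_insert_of_mem hA),
          hx B (mem_insert_self _ _)⟩⟩
      -- hence `|C| ≥ t`
      have hCt : t ≤ C.card := by
        by_contra! hlt
        obtain ⟨B, hB, hdisj⟩ := ht C hlt
        obtain ⟨x, hx⟩ := hCblock B hB
        exact disjoint_left.mp hdisj (mem_inter.mp hx).1 (mem_inter.mp hx).2
      -- a subset `S ⊆ C` with `t - 1` points does not block: some member `A'` avoids it
      obtain ⟨S, hSC, hScard⟩ := exists_subset_card_eq (show t - 1 ≤ C.card by omega)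
      obtain ⟨A', hA', hSA'⟩ := ht S (by omega)
      refine ⟨insert A' 𝓖, insert_subset hA' h𝓖𝓕, insert_nonempty _ _,
        (card_insert_le _ _).trans (by omega), C ∩ A', fun x => ?_, ?_⟩
      · rw [mem_inter, forall_mem_insert, hC]
        tauto
      · have hsub : C ∩ A' ⊆ C \ S := by
          intro x hx
          rw [mem_inter] at hx
          exact mem_sdiff.mpr ⟨hx.1, fun hxS => disjoint_left.mp hSA' hxS hx.2⟩
        have h1 := card_le_card hsub
        rw [card_sdiff_of_subset hSC, hScard] at h1
        have ej : (j + 1 - 1) * (t - 1) = (j - 1) * (t - 1) + (t - 1) := by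
          rw [Nat.add_sub_cancel]
          conv_lhs => rw [show j = (j - 1) + 1 by omega]
          ring
        rw [ej]
        omega
  obtain ⟨𝓖, h𝓖𝓕, h𝓖ne, h𝓖card, C, hC, hCcard⟩ := claim k (by omega) le_rfl
  obtain ⟨x, hx⟩ := hk 𝓖 h𝓖𝓕 h𝓖ne h𝓖card
  have h1 : 1 ≤ C.card := card_pos.mpr ⟨x, (hC x).mpr hx⟩
  have ek : (t - 1) * (k - 1) = (k - 1) * (t - 1) := mul_comm _ _
  rw [ek]
  omega

/-- **Theorem 10.11** (Bollobás 1965). If each family of at most `binom(s+r, r)` members of an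
`r`-uniform family `𝓕` can be blocked by `s` points, then all members can.

Printed proof: otherwise take a `τ`-critical subfamily `𝓕' = {A_1, …, A_m}` with `τ(𝓕') = s + 1`
(here: a subfamily of minimum cardinality that cannot be blocked by `s` points); each `𝓕' - {A_i}`
has a blocking set `B_i` of size `≤ s`, so `A_j ∩ B_i ≠ ∅` for `j ≠ i` and `A_i ∩ B_i = ∅`, and
Bollobás's theorem (Theorem 9.8, `sum_bollobasWeight_le_one`) gives `m ≤ binom(s+r, r)`, so `𝓕'`
could be blocked after all. [cite: Jukna2001, Ch. 10 §10.3, Theorem 10.11 and its proof;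
Bollobas1965] -/
theorem bollobas_blocking_helly (𝓕 : Finset (Finset α)) (r s : ℕ) (hr : ∀ A ∈ 𝓕, A.card = r)
    (h : ∀ 𝓖 ⊆ 𝓕, 𝓖.card ≤ (s + r).choose r →
      ∃ T : Finset α, T.card ≤ s ∧ ∀ A ∈ 𝓖, (T ∩ A).Nonempty) :
    ∃ T : Finset α, T.card ≤ s ∧ ∀ A ∈ 𝓕, (T ∩ A).Nonempty := by
  classical
  by_contra hnot
  -- a subfamily of minimum cardinality that cannot be blocked by `s` points
  set bad := 𝓕.powerset.filter fun 𝓖 =>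
    ¬ ∃ T : Finset α, T.card ≤ s ∧ ∀ A ∈ 𝓖, (T ∩ A).Nonempty with hbad
  have hbadne : bad.Nonempty := ⟨𝓕, mem_filter.mpr ⟨mem_powerset_self 𝓕, hnot⟩⟩
  obtain ⟨𝓕', h𝓕'bad, hmin⟩ := exists_min_image bad card hbadne
  simp only [hbad, mem_filter, mem_powerset] at h𝓕'bad
  obtain ⟨h𝓕'𝓕, h𝓕'no⟩ := h𝓕'bad
  -- each `𝓕' - {A}` can be blocked by `s` points
  have hB : ∀ A ∈ 𝓕', ∃ T : Finset α, T.card ≤ s ∧ ∀ A' ∈ 𝓕'.erase A, (T ∩ A').Nonempty := by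
    intro A hA
    by_contra hno
    have hmem : 𝓕'.erase A ∈ bad := by
      simp only [hbad, mem_filter, mem_powerset]
      exact ⟨(erase_subset _ _).trans h𝓕'𝓕, hno⟩
    have h1 := hmin _ hmem
    rw [card_erase_of_mem hA] at h1
    have h2 : 0 < 𝓕'.card := card_pos.mpr ⟨A, hA⟩
    omega
  choose! B hBcard hBblock using hB
  -- the Bollobás pairs `(A, B_A)`, `A ∈ 𝓕'`
  have hdisj : ∀ i : ↥𝓕', Disjoint i.1 (B i.1) := by
    rintro ⟨A, hA⟩
    rw [disjoint_iff_inter_eq_empty, ← not_nonempty_iff_eq_empty]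
    intro hne
    refine h𝓕'no ⟨B A, hBcard A hA, fun A' hA' => ?_⟩
    by_cases hAA' : A' = A
    · rw [hAA', inter_comm]
      exact hne
    · exact hBblock A hA A' (mem_erase.mpr ⟨hAA', hA'⟩)
  have hcross : ∀ i j : ↥𝓕', i ≠ j → ¬ Disjoint i.1 (B j.1) := by
    rintro ⟨A, hA⟩ ⟨A', hA'⟩ hne hd
    have hAA' : A ≠ A' := fun h => hne (Subtype.ext h)
    obtain ⟨x, hx⟩ := hBblock A' hA' A (mem_erase.mpr ⟨hAA', hA⟩)
    rw [mem_inter] at hx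
    exact disjoint_left.mp hd hx.2 hx.1
  have hsum := sum_bollobasWeight_le_one (fun i : ↥𝓕' => i.1) (fun i => B i.1) hdisj hcross
  have hpos : (0 : ℚ) < (((s + r).choose r : ℕ) : ℚ) := by
    exact_mod_cast Nat.choose_pos (Nat.le_add_left _ _)
  -- each term is at least `binom(s+r, r)^{-1}`
  have hterm : ∀ i : ↥𝓕', ((((s + r).choose r : ℕ) : ℚ))⁻¹ ≤
      ((((i.1.card + (B i.1).card).choose i.1.card : ℕ) : ℚ))⁻¹ := by
    rintro ⟨A, hA⟩
    apply inv_anti₀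
    · exact_mod_cast Nat.choose_pos (Nat.le_add_right _ _)
    · have hle : (A.card + (B A).card).choose A.card ≤ (s + r).choose r := by
        rw [hr A (h𝓕'𝓕 hA), add_comm s r]
        exact Nat.choose_le_choose r (by have := hBcard A hA; omega)
      exact_mod_cast hle
  have hcard : (𝓕'.card : ℚ) * ((((s + r).choose r : ℕ) : ℚ))⁻¹ ≤ 1 := by
    calc (𝓕'.card : ℚ) * ((((s + r).choose r : ℕ) : ℚ))⁻¹
        = ∑ _i : ↥𝓕', ((((s + r).choose r : ℕ) : ℚ))⁻¹ := by
          rw [sum_const, card_univ, Fintype.card_coe, nsmul_eq_mul]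
      _ ≤ ∑ i : ↥𝓕', ((((i.1.card + (B i.1).card).choose i.1.card : ℕ) : ℚ))⁻¹ :=
          sum_le_sum fun i _ => hterm i
      _ ≤ 1 := hsum
  rw [mul_inv_le_iff₀ hpos, one_mul] at hcard
  have hle : 𝓕'.card ≤ (s + r).choose r := by exact_mod_cast hcard
  exact h𝓕'no (h 𝓕' h𝓕'𝓕 hle)

/-- **Theorem 10.10** (Erdős–Hajnal–Moon 1964). If each family of at most `binom(s+2, 2)` edges of a
graph can be covered by `s` vertices, then all edges can (graphs are 2-uniform families; the case
`r = 2` of Theorem 10.11). [cite: Jukna2001, Ch. 10 §10.3, Theorem 10.10;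
ErdosHajnalMoon1964] -/
theorem erdos_hajnal_moon (𝓔 : Finset (Finset α)) (s : ℕ) (h2 : ∀ e ∈ 𝓔, e.card = 2)
    (h : ∀ 𝓖 ⊆ 𝓔, 𝓖.card ≤ (s + 2).choose 2 →
      ∃ T : Finset α, T.card ≤ s ∧ ∀ e ∈ 𝓖, (T ∩ e).Nonempty) :
    ∃ T : Finset α, T.card ≤ s ∧ ∀ e ∈ 𝓔, (T ∩ e).Nonempty :=
  bollobas_blocking_helly 𝓔 2 s h2 h

end Literature.Combinatorics.SetFamily
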